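import Literature.Topology.ClosedFiltrationEnumeration                    -- ★ p849243 (this seat): `exists_enum_forall_isClosed_iUnion_lt`
import Literature.NumberTheory.Rogawski1990.UnitaryThreeUnipotentStrataCM   -- ★ p849223 (LH4-p01 (g0)): (S1) `isClosed_setOf_sub_one_pow_eq_zero`, (S2) `exists_isOpen_forall_sameStratum_mem_iff_isConj`
import HarnessLib

/-!
# The closed filtration of `U(H)(L⁺_v)` by unipotent conjugacy classes: an enumeration of the unipotent classes with closed initial unions
(Rogawski (1990), §3.9 Prop. 3.9.1 p. 32, §8.1 pp. 112–113; Bernstein–Zelevinsky (1976), §1.5)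

Topic `NumberTheory/Rogawski1990`; namespace `Literature.NumberTheory.Rogawski1990`.  THEOREMS ONLY (no def, no instance, no named fact, no `sorry`).

The span property of Howe ∕ Harish-Chandra for the unipotent orbital integrals (the in-house organ ‹SPAN› of the Shalika germ expansion for `U(3)`) inducts along a
filtration `∅ = Z₀ ⊆ Z₁ ⊆ ⋯ ⊆ Z_n = {(γ−1)³ = 0}` of `G = U(H)(L⁺_v)` by CLOSED conjugation-stable sets whose successive differences are single classes.  This file
produces it:
* §1 (any `H ∈ M₃(L)`, any finite place) `npow_conj_sub_one_eq_zero_iff` (the strata `{(γ−1)^k = 0}` are conjugation-stable) and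
  `exists_enum_unipotent_isClosed_iUnion_lt` — HYPOTHESIS FORM: closed strata (S1) + «each class open in its stratum» (S2) ⇒ the enumeration (★ generic
  `Literature.Topology.exists_enum_forall_isClosed_iUnion_lt`);
* §2 (`H = Φ₃`, odd non-split place) `exists_enum_unipotent_isClosed_iUnion_lt_antidiagOne_odd` — UNCONDITIONAL, (S1)∕(S2) being ★ `UnitaryThreeUnipotentStrataCM`.
HC_CM is proved only modulo the printed citations until rung 0 closes; this file discharges none of them.

## References
* [Rogawski1990] J. D. Rogawski, *Automorphic Representations of Unitary Groups in Three Variables*, Ann. of Math. Stud. 123 (1990), §3.9 Prop. 3.9.1 p. 32; §8.1 pp. 112–113.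
* [BernsteinZelevinsky1976] I. N. Bernstein, A. V. Zelevinsky, *Representations of the group GL(n, F) where F is a non-archimedean local field*, Russian Math. Surveys
  31:3 (1976) 1–68, §1.5.
-/

noncomputable section

open Topology Set NumberField IsDedekindDomain Matrix
open scoped Valued Matrix MatrixGroups

namespace Literature.NumberTheory.Rogawski1990

open Literature.NumberTheory.Automorphic Literature.NumberTheory.Automorphic.UnitaryGroup

/-! ## §1 Any `H ∈ M₃(L)`, any finite place: conjugation invariance; the enumeration from (S1) + (S2) -/

section Strata

variable (L : Type) [Field L] [NumberField L] [IsCMField L] (H : Matrix (Fin 3) (Fin 3) L) (v : HeightOneSpectrum (𝓞 ↥(maximalRealSubfield L)))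

/-- **Conjugation invariance of the unipotent strata**: `(x g x⁻¹ − 1)^k = 0 ↔ (g − 1)^k = 0` in `U(H)(L⁺_v) ≤ GL₃(L ⊗ L⁺_v)` (any `H`, any finite place;
`(x g x⁻¹ − 1)^k = x (g − 1)^k x⁻¹`). [cite: Rogawski1990, §3.9 p. 32] -/
theorem npow_conj_sub_one_eq_zero_iff (g x : (cmDatum L 3 H).Local v) (k : ℕ) :
    (((x * g * x⁻¹).val : GL (Fin 3) (UnitaryGroup.LocalRing L v)).val - 1) ^ k = 0 ↔
      ((g.val : GL (Fin 3) (UnitaryGroup.LocalRing L v)).val - 1) ^ k = 0 := by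
  have hval : ((x * g * x⁻¹).val : GL (Fin 3) (UnitaryGroup.LocalRing L v)) = x.val * g.val * (x.val)⁻¹ := rfl
  have hconj : (((x * g * x⁻¹).val : GL (Fin 3) (UnitaryGroup.LocalRing L v)).val - 1) =
      (x.val : GL (Fin 3) (UnitaryGroup.LocalRing L v)).val *
        (((g.val : GL (Fin 3) (UnitaryGroup.LocalRing L v)).val - 1)) * ((x.val : GL (Fin 3) (UnitaryGroup.LocalRing L v))⁻¹).val := by
    rw [hval, Units.val_mul, Units.val_mul, mul_sub, sub_mul, mul_one, Units.mul_inv]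
  rw [hconj, Units.conj_pow]
  constructor
  · intro h
    calc (((g.val : GL (Fin 3) (UnitaryGroup.LocalRing L v)).val - 1)) ^ k
        = ((x.val : GL (Fin 3) (UnitaryGroup.LocalRing L v))⁻¹).val *
            ((x.val : GL (Fin 3) (UnitaryGroup.LocalRing L v)).val *
              (((g.val : GL (Fin 3) (UnitaryGroup.LocalRing L v)).val - 1)) ^ k * ((x.val : GL (Fin 3) (UnitaryGroup.LocalRing L v))⁻¹).val) *
            (x.val : GL (Fin 3) (UnitaryGroup.LocalRing L v)).val := by
          rw [← mul_assoc, ← mul_assoc, Units.inv_mul, one_mul, mul_assoc, Units.inv_mul, mul_one]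
      _ = 0 := by rw [h, mul_zero, zero_mul]
  · intro h
    rw [h, mul_zero, zero_mul]

set_option maxHeartbeats 800000 in
-- a long combinatorial verification over one carrier
/-- **The closed enumeration of the unipotent classes of `U(H)(L⁺_v)`, hypothesis form** (any `H ∈ M₃(L)`, any finite place): GIVEN (S1) the strata
`{(γ−1)^k = 0}` are closed and (S2) each unipotent class is cut out by an open set inside its stratum `{1}` ∕ `{(γ−1)²=0} ∖ {1}` ∕ `{(γ−1)³=0} ∖ {(γ−1)²=0}`, a
finite set `S` of classes with `c ∈ S ↔ (γ_c − 1)³ = 0` admits `e : Fin n → ConjClasses G` enumerating `S` with `⋃_{i<k} 𝒪(e i)` CLOSED for every `k`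
(★ `Literature.Topology.exists_enum_forall_isClosed_iUnion_lt` with `W k = {0 < k ∧ (γ−1)^{min k 3} = 0}`, ranks `0 ∕ 1 ∕ 2`, cells the class carriers) — the
closed filtration `{1} ⊂ {(γ−1)²=0} ⊂ {(γ−1)³=0}` refined class by class. [cite: Rogawski1990, §3.9 Prop. 3.9.1 p. 32; §8.1 p. 112] [cite: BernsteinZelevinsky1976, §1.5] -/
theorem exists_enum_unipotent_isClosed_iUnion_lt
    (S : Finset (ConjClasses ((cmDatum L 3 H).Local v)))
    (hS : ∀ c : ConjClasses ((cmDatum L 3 H).Local v), c ∈ S ↔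
      (((Quotient.out c : (cmDatum L 3 H).Local v).val : GL (Fin 3) (UnitaryGroup.LocalRing L v)).val - 1) ^ 3 = 0)
    (hS1 : ∀ k : ℕ, IsClosed {γ : (cmDatum L 3 H).Local v | ((γ.val : GL (Fin 3) (UnitaryGroup.LocalRing L v)).val - 1) ^ k = 0})
    (hS2 : ∀ u : (cmDatum L 3 H).Local v, ((u.val : GL (Fin 3) (UnitaryGroup.LocalRing L v)).val - 1) ^ 3 = 0 →
      ∃ V : Set ((cmDatum L 3 H).Local v), IsOpen V ∧ ∀ γ : (cmDatum L 3 H).Local v,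
        (((γ.val : GL (Fin 3) (UnitaryGroup.LocalRing L v)).val - 1) ^ 3 = 0 ∧
          (((γ.val : GL (Fin 3) (UnitaryGroup.LocalRing L v)).val - 1) ^ 2 = 0 ↔ ((u.val : GL (Fin 3) (UnitaryGroup.LocalRing L v)).val - 1) ^ 2 = 0) ∧
          (γ = 1 ↔ u = 1)) → (γ ∈ V ↔ IsConj u γ)) :
    ∃ (n : ℕ) (e : Fin n → ConjClasses ((cmDatum L 3 H).Local v)),
      (∀ c, c ∈ S ↔ ∃ i, e i = c) ∧ ∀ k : ℕ, IsClosed (⋃ (i : Fin n) (_ : i.val < k), (e i).carrier) := by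
  classical
  obtain ⟨nγ, hn⟩ : ∃ nγ : (cmDatum L 3 H).Local v → Matrix (Fin 3) (Fin 3) (UnitaryGroup.LocalRing L v),
      ∀ γ, ((γ.val : GL (Fin 3) (UnitaryGroup.LocalRing L v)).val - 1) = nγ γ := ⟨_, fun _ => rfl⟩
  have hconj : ∀ (g x : (cmDatum L 3 H).Local v) (k : ℕ), nγ (x * g * x⁻¹) ^ k = 0 ↔ nγ g ^ k = 0 := fun g x k => by
    have h := npow_conj_sub_one_eq_zero_iff L H v g x k
    simp only [hn] at h
    exact h
  simp only [hn] at hS hS1 hS2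
  -- conjugation invariance along `IsConj`
  have hIsConj : ∀ (g y : (cmDatum L 3 H).Local v) (k : ℕ), IsConj g y → (nγ y ^ k = 0 ↔ nγ g ^ k = 0) := fun g y k h => by
    obtain ⟨c, rfl⟩ := isConj_iff.1 h
    exact hconj g c k
  have hout : ∀ c : ConjClasses ((cmDatum L 3 H).Local v), ConjClasses.mk (Quotient.out c) = c := fun c => Quotient.out_eq c
  have hmemA : ∀ (γ : (cmDatum L 3 H).Local v) (c : ConjClasses ((cmDatum L 3 H).Local v)), γ ∈ c.carrier ↔ IsConj (Quotient.out c) γ := fun γ c => by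
    constructor
    · intro h
      exact (ConjClasses.mk_eq_mk_iff_isConj.1 ((hout c).trans (ConjClasses.mem_carrier_iff_mk_eq.1 h).symm))
    · intro h
      exact ConjClasses.mem_carrier_iff_mk_eq.2 ((ConjClasses.mk_eq_mk_iff_isConj.2 h).symm.trans (hout c))
  have hone : ∀ γ : (cmDatum L 3 H).Local v, nγ γ = 0 ↔ γ = 1 := fun γ => by
    rw [← hn γ, sub_eq_zero, Units.val_eq_one, OneMemClass.coe_eq_one]
    exact Iff.rfl
  have hpow1 : ∀ γ : (cmDatum L 3 H).Local v, nγ γ ^ 1 = 0 ↔ nγ γ = 0 := fun γ => by rw [pow_one]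
  -- strata, ranks, cells
  obtain ⟨W, hW⟩ : ∃ W : ℕ → Set ((cmDatum L 3 H).Local v), W = fun k => {γ | 0 < k ∧ nγ γ ^ (min k 3) = 0} := ⟨_, rfl⟩
  obtain ⟨rk, hrk⟩ : ∃ rk : ConjClasses ((cmDatum L 3 H).Local v) → ℕ,
      rk = fun c => if nγ (Quotient.out c) = 0 then 0 else if nγ (Quotient.out c) ^ 2 = 0 then 1 else 2 := ⟨_, rfl⟩
  have hWmem : ∀ (k : ℕ) (γ : (cmDatum L 3 H).Local v), γ ∈ W k ↔ 0 < k ∧ nγ γ ^ (min k 3) = 0 := fun k γ => by rw [hW]; rfl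
  have hW1 : ∀ γ : (cmDatum L 3 H).Local v, γ ∈ W 1 ↔ nγ γ = 0 := fun γ => by
    rw [hWmem, show min 1 3 = 1 from rfl, pow_one]; exact ⟨fun h => h.2, fun h => ⟨Nat.one_pos, h⟩⟩
  have hW2 : ∀ γ : (cmDatum L 3 H).Local v, γ ∈ W 2 ↔ nγ γ ^ 2 = 0 := fun γ => by
    rw [hWmem, show min 2 3 = 2 from rfl]; exact ⟨fun h => h.2, fun h => ⟨two_pos, h⟩⟩
  have hWsucc3 : ∀ (k : ℕ) (γ : (cmDatum L 3 H).Local v), γ ∈ W (k + 1) → nγ γ ^ 3 = 0 := fun k γ h =>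
    pow_eq_zero_of_le (min_le_right _ _) ((hWmem _ _).1 h).2
  have hsq_of_one : ∀ γ : (cmDatum L 3 H).Local v, nγ γ = 0 → nγ γ ^ 2 = 0 := fun γ h => by rw [h, zero_pow two_ne_zero]
  have hrk_cases : ∀ c ∈ S, (rk c = 0 ∧ nγ (Quotient.out c) = 0) ∨ (rk c = 1 ∧ nγ (Quotient.out c) ≠ 0 ∧ nγ (Quotient.out c) ^ 2 = 0) ∨
      (rk c = 2 ∧ nγ (Quotient.out c) ≠ 0 ∧ nγ (Quotient.out c) ^ 2 ≠ 0) := fun c _ => by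
    by_cases h0 : nγ (Quotient.out c) = 0
    · exact Or.inl ⟨by rw [hrk]; exact if_pos h0, h0⟩
    by_cases h1 : nγ (Quotient.out c) ^ 2 = 0
    · exact Or.inr (Or.inl ⟨by rw [hrk]; simp only [h0, h1, if_false, if_true], h0, h1⟩)
    · exact Or.inr (Or.inr ⟨by rw [hrk]; simp only [h0, h1, if_false], h0, h1⟩)
  -- membership of the stratum `W (rk c + 1) ∖ W (rk c)` in terms of `nγ`
  have hstratum : ∀ c ∈ S, ∀ γ : (cmDatum L 3 H).Local v, (nγ γ ^ 3 = 0 ∧ (nγ γ ^ 2 = 0 ↔ nγ (Quotient.out c) ^ 2 = 0) ∧ (nγ γ = 0 ↔ nγ (Quotient.out c) = 0)) ↔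
      (γ ∈ W (rk c + 1) ∧ γ ∉ W (rk c)) := fun c hc γ => by
    have h3c : nγ (Quotient.out c) ^ 3 = 0 := (hS c).1 hc
    rcases hrk_cases c hc with ⟨hr, h0⟩ | ⟨hr, h0, h1⟩ | ⟨hr, h0, h1⟩
    · rw [hr, zero_add, hW1, hWmem]
      refine ⟨fun ⟨_, _, h⟩ => ⟨h.2 h0, fun h' => Nat.lt_irrefl 0 h'.1⟩, fun ⟨h, _⟩ => ⟨?_, ?_, ?_⟩⟩
      · rw [h, zero_pow three_ne_zero]
      · exact ⟨fun _ => hsq_of_one _ h0, fun _ => hsq_of_one _ h⟩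
      · exact ⟨fun _ => h0, fun _ => h⟩
    · rw [hr, hW2, hW1]
      refine ⟨fun ⟨_, h2, h1'⟩ => ⟨h2.2 h1, fun h' => h0 (h1'.1 h')⟩, fun ⟨h2, h1'⟩ => ⟨?_, ?_, ?_⟩⟩
      · exact pow_eq_zero_of_le (by norm_num) h2
      · exact ⟨fun _ => h1, fun _ => h2⟩
      · exact ⟨fun h => absurd h h1', fun h => absurd h h0⟩
    · rw [hr, hW2, hWmem, show min (2 + 1) 3 = 3 from rfl]
      refine ⟨fun ⟨h3, h2, h1'⟩ => ⟨⟨by norm_num, h3⟩, fun h' => h1 (h2.1 h')⟩, fun ⟨⟨_, h3⟩, h2⟩ => ⟨h3, ?_, ?_⟩⟩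
      · exact ⟨fun h => absurd h h2, fun h => absurd h h1⟩
      · exact ⟨fun h => absurd (hsq_of_one _ h) h2, fun h => absurd h h0⟩
  refine Literature.Topology.exists_enum_forall_isClosed_iUnion_lt S (fun c => c.carrier) rk W ?_ ?_ ?_ ?_ ?_ ?_ ?_
  · -- W 0 = ∅
    ext γ; rw [hWmem]; simp
  · -- monotone
    intro a b hab γ h
    rw [hWmem] at h ⊢
    exact ⟨lt_of_lt_of_le h.1 hab, pow_eq_zero_of_le (min_le_min_right 3 hab) h.2⟩
  · -- closed strata (S1)
    intro k
    by_cases hk : 0 < k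
    · have hWk : W k = {γ | nγ γ ^ (min k 3) = 0} := Set.ext fun γ => by rw [hWmem]; exact ⟨fun h => h.2, fun h => ⟨hk, h⟩⟩
      rw [hWk]; exact hS1 _
    · have hWk : W k = ∅ := Set.ext fun γ => by rw [hWmem]; exact ⟨fun h => absurd h.1 hk, fun h => absurd h (Set.notMem_empty _)⟩
      rw [hWk]; exact isClosed_empty
  · -- cells lie in their stratum
    intro c hc
    have hγ : ∀ γ ∈ c.carrier, γ ∈ W (rk c + 1) ∧ γ ∉ W (rk c) := fun γ hγ => by
      have hic : IsConj (Quotient.out c) γ := (hmemA γ c).1 hγ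
      exact (hstratum c hc γ).1 ⟨(hIsConj _ _ 3 hic).2 ((hS c).1 hc), hIsConj _ _ 2 hic, by rw [← hpow1, ← hpow1 (Quotient.out c)]; exact hIsConj _ _ 1 hic⟩
    exact ⟨fun γ h => (hγ γ h).1, Set.disjoint_left.2 fun γ h h' => (hγ γ h).2 h'⟩
  · -- strata are covered by cells of that rank
    intro k x hx hx'
    have hx3 : nγ x ^ 3 = 0 := hWsucc3 k x hx
    have hcS : ConjClasses.mk x ∈ S := (hS _).2 ((hIsConj _ _ 3 ((hmemA x _).1 (ConjClasses.mem_carrier_iff_mk_eq.2 rfl))).1 hx3)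
    refine ⟨ConjClasses.mk x, hcS, ?_, ConjClasses.mem_carrier_iff_mk_eq.2 rfl⟩
    have hic : IsConj (Quotient.out (ConjClasses.mk x)) x := (hmemA x _).1 (ConjClasses.mem_carrier_iff_mk_eq.2 rfl)
    have hxs : x ∈ W (rk (ConjClasses.mk x) + 1) ∧ x ∉ W (rk (ConjClasses.mk x)) :=
      (hstratum _ hcS x).1 ⟨hx3, hIsConj _ _ 2 hic, by rw [← hpow1, ← hpow1 (Quotient.out _)]; exact hIsConj _ _ 1 hic⟩
    -- the rank is determined by the stratum containing `x`
    by_contra hne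
    rcases Nat.lt_or_gt_of_ne hne with hlt | hgt
    · -- rk < k : then x ∈ W (rk+1) ⊆ W k, contradiction
      exact hx' ((show W (rk (ConjClasses.mk x) + 1) ⊆ W k from fun γ h => by
        rw [hWmem] at h ⊢; exact ⟨by omega, pow_eq_zero_of_le (min_le_min_right 3 (by omega)) h.2⟩) hxs.1)
    · -- k < rk : then x ∈ W (k+1) ⊆ W rk, contradiction
      exact hxs.2 ((show W (k + 1) ⊆ W (rk (ConjClasses.mk x)) from fun γ h => by
        rw [hWmem] at h ⊢; exact ⟨by omega, pow_eq_zero_of_le (min_le_min_right 3 (by omega)) h.2⟩) hx)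
  · -- (S2): cells are open in their stratum
    intro c hc
    obtain ⟨V, hVo, hV⟩ := hS2 (Quotient.out c) ((hS c).1 hc)
    refine ⟨V, hVo, fun x hx hx' => ?_⟩
    obtain ⟨h3, h2, h1⟩ := (hstratum c hc x).2 ⟨hx, hx'⟩
    rw [hmemA]
    exact hV x ⟨h3, h2, by rw [← hone, ← hone]; exact h1⟩
  · -- distinct classes are disjoint
    intro c _ c' _ hcc'
    exact Set.disjoint_left.2 fun γ h h' => hcc' ((ConjClasses.mem_carrier_iff_mk_eq.1 h).symm.trans (ConjClasses.mem_carrier_iff_mk_eq.1 h'))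

end Strata

/-! ## §2 `G = U(Φ₃)(L⁺_v)` at an ODD non-split place: (S1), (S2) discharged -/

set_option maxHeartbeats 400000 in
-- statement-heavy carrier
/-- **The closed enumeration of the unipotent classes of `U(Φ₃)(L⁺_v)` at an odd non-split place** — UNCONDITIONAL: (S1) ★ `isClosed_setOf_sub_one_pow_eq_zero` and
(S2) ★ `exists_isOpen_forall_sameStratum_mem_iff_isConj` (`UnitaryThreeUnipotentStrataCM`) discharge the hypotheses of `exists_enum_unipotent_isClosed_iUnion_lt`.  For
every finite `S` with `c ∈ S ↔ (γ_c − 1)³ = 0`: `∃ n (e : Fin n → ConjClasses G), (∀ c, c ∈ S ↔ ∃ i, e i = c) ∧ ∀ k, IsClosed (⋃_{i<k} 𝒪(e i))` — the `hfilt` input of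
the Howe ∕ Harish-Chandra span property for the unipotent orbital integrals of `U(3)`. [cite: Rogawski1990, §3.9 Prop. 3.9.1 p. 32; §8.1 pp. 112–113]
[cite: BernsteinZelevinsky1976, §1.5] -/
theorem exists_enum_unipotent_isClosed_iUnion_lt_antidiagOne_odd (L : Type) [Field L] [NumberField L] [IsCMField L]
    (v : HeightOneSpectrum (𝓞 ↥(maximalRealSubfield L))) (w : UnitaryGroup.PlacesOver L v) (hsub : Subsingleton (UnitaryGroup.PlacesOver L v))
    (h2 : IsUnit (2 : 𝒪[w.1.adicCompletion L]))
    (S : Finset (ConjClasses ((cmDatum L 3 (Matrix.of fun i j : Fin 3 => if i.val + j.val + 1 = 3 then (1 : L) else 0)).Local v)))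
    (hS : ∀ c : ConjClasses ((cmDatum L 3 (Matrix.of fun i j : Fin 3 => if i.val + j.val + 1 = 3 then (1 : L) else 0)).Local v), c ∈ S ↔
      (((Quotient.out c : (cmDatum L 3 (Matrix.of fun i j : Fin 3 => if i.val + j.val + 1 = 3 then (1 : L) else 0)).Local v).val : GL (Fin 3) (UnitaryGroup.LocalRing L v)).val - 1) ^ 3 = 0) :
    ∃ (n : ℕ) (e : Fin n → ConjClasses ((cmDatum L 3 (Matrix.of fun i j : Fin 3 => if i.val + j.val + 1 = 3 then (1 : L) else 0)).Local v)),
      (∀ c, c ∈ S ↔ ∃ i, e i = c) ∧ ∀ k : ℕ, IsClosed (⋃ (i : Fin n) (_ : i.val < k), (e i).carrier) :=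
  exists_enum_unipotent_isClosed_iUnion_lt L _ v S hS (isClosed_setOf_sub_one_pow_eq_zero L v w hsub h2)
    (exists_isOpen_forall_sameStratum_mem_iff_isConj L v w hsub h2)

end Literature.NumberTheory.Rogawski1990
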